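import Mathlib
import Literature.Analysis.FluidPDE.LerayHopf
import Summits.NavierStokesRegularity.NavierStokesRegularity.Theorems.QuarterJoltEnergyJumpLaw
import HarnessLib

/-!
# RootDecompEpochRecut — crux NLA `NoLateAtom` (stmt-NavierStokesRegularity-30479), stub `stub_lerayHopfLeftRadonRiesz`

Registered stub (writer g11 first-prover skeleton `NoLateAtom_line.lean`, 2026-08-30T22:06Z; = aside item
stmt-NavierStokesRegularity-30482 `LerayHopfLeftRadonRiesz` verbatim), PROVED here verbatim:
**Radon–Riesz in Leray's class at an epoch.** For a global Leray–Hopf flow `u` (force `0`, datum `u₀`) and an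
epoch `τ > 0`, continuity of the energy from the left at `τ` (`∫‖u t‖² → ∫‖u τ‖²` as `t ↑ τ`) gives STRONG
`L²`-convergence `‖u t − u τ‖_{L²} → 0` as `t ↑ τ`.

Proof: `IsGlobalLerayHopf ν 0 u₀ u` restricted to `[0, τ]` is `IsLerayHopfOn τ ν 0 u₀ u`, whose field
`weak_continuous` (weak `L²`-continuity of the slices on `(0, τ]`) is exactly what the tree's Radon–Riesz lemmas
`NoTerminalJolt.tendsto_integral_norm_sq_iff_tendsto_integral_norm_sub_sq` (energy continuity ⟺ `∫‖u t − u τ‖² → 0`,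
via `‖a − b‖² = (‖a‖² − ‖b‖²) + 2(‖b‖² − ⟪a, b⟫)`) and
`NoTerminalJolt.tendsto_eLpNorm_sub_iff_tendsto_integral_norm_sub_sq` (`eLpNorm` form) consume — both are stated
for an arbitrary force and datum (`Theorems/QuarterJoltEnergyJumpLaw.lean`). Pure plumbing; no PDE.
Decoration toward S (the plumbing half of a crux whose content is the energy-continuity stub
`stub_clayFlowEnergyContinuity`); Navier–Stokes regularity is NOT proved by anything here (rung 0).
-/

-- the summit and its single sub-problem share the name (CONVENTIONS §1), as in every Theorems file
set_option linter.dupNamespace false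

open MeasureTheory Set Filter Topology
open Literature.Analysis.FluidPDE

namespace Summit.NavierStokesRegularity.NavierStokesRegularity.Theorems.NoLateAtom

/-- **Radon–Riesz in Leray's class at an epoch** (registered stub `stub_lerayHopfLeftRadonRiesz` of the
first-prover skeleton for `NoLateAtom`, = aside `LerayHopfLeftRadonRiesz` stmt-NavierStokesRegularity-30482):
for a global Leray–Hopf flow `u` with viscosity `ν > 0`, zero force and datum `u₀`, and an epoch `τ > 0`, if
`∫‖u t‖² → ∫‖u τ‖²` as `t ↑ τ` then `‖u t − u τ‖_{L²} → 0` as `t ↑ τ` (weak `L²`-continuity of Leray–Hopf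
slices + norm convergence ⟹ strong convergence in the Hilbert space `L²`; Robinson–Rodrigo–Sadowski 2016,
Lemma 3.8 pattern). [folklore] -/
theorem stub_lerayHopfLeftRadonRiesz :
    ∀ ν : ℝ, 0 < ν → ∀ (u₀ : EuclideanSpace ℝ (Fin 3) → EuclideanSpace ℝ (Fin 3)) (u : ℝ → EuclideanSpace ℝ (Fin 3) → EuclideanSpace ℝ (Fin 3)), Literature.Analysis.FluidPDE.IsGlobalLerayHopf ν 0 u₀ u → ∀ τ : ℝ, 0 < τ → Filter.Tendsto (fun t => ∫ x, ‖u t x‖ ^ 2) (nhdsWithin τ (Set.Iio τ)) (nhds (∫ x, ‖u τ x‖ ^ 2)) → Filter.Tendsto (fun t => MeasureTheory.eLpNorm (u t - u τ) 2 MeasureTheory.volume) (nhdsWithin τ (Set.Iio τ)) (nhds 0) := by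
  intro ν _hν u₀ u hG τ hτ hE
  -- Leray–Hopf on `[0, τ]` (restriction of the global structure)
  have hLH : IsLerayHopfOn τ ν 0 u₀ u := hG τ hτ
  exact (NoTerminalJolt.tendsto_eLpNorm_sub_iff_tendsto_integral_norm_sub_sq hτ hLH).2
    ((NoTerminalJolt.tendsto_integral_norm_sq_iff_tendsto_integral_norm_sub_sq hτ hLH).1 hE)

end Summit.NavierStokesRegularity.NavierStokesRegularity.Theorems.NoLateAtom
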